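import Summits.ValiantsHypothesis.ValiantsHypothesis.Theorems.SymPencilPerFourSixDimZeroCol
import Summits.ValiantsHypothesis.ValiantsHypothesis.Theorems.SymPencilPerFourSixDimGraph
import Summits.ValiantsHypothesis.ValiantsHypothesis.Theorems.SymPencilPerFourSixDimBlock
import Summits.ValiantsHypothesis.ValiantsHypothesis.Theorems.SymPencilPerFourSixDimCross
import Summits.ValiantsHypothesis.ValiantsHypothesis.Theorems.SymPencilSdcPerFourTwentySixReduction

/-!
# Route `SymPencil` — the `(10, 6)` cell: a detecting pair is impossible, and `H106` modulo the
# structural residual `R6` (assembly of bricks (B), (C), (D1), (D2) of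
# `Cruxes/SdcSuperquadratic/NEXT-RUNG-25.md`; `--supports` stmt-ValiantsHypothesis-5674)

**Theorem** (`false_of_detecting_rows_six`).  Over a field of characteristic `0`, no
`6`-dimensional `V ⊆ Sing Z(per_4)` with a DETECTING pair of rows carries both a per-base-point
family (`S1`) and a per-direction family (`S2`) of `< 6` squares of the `s²`-coefficient of
`per_4 (u + s y)`.  Proof: (D1) `SymPencilPerFourSixDimZeroCol` — the per-direction minors force a
zero column on the detecting rows; (D2) `SymPencilPerFourSixDimGraph` — the `3 × 3` subpermanents
then force the two other rows to vanish, so `V` is a `2 × 3` block; (B)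
`SymPencilPerFourSixDimBlock` — a `2 × 3` block has a per-base-point form of rank `6`.  Columns:
transpose (`false_of_detecting_cols_six`).  With (C) `SymPencilPerFourSixDimCross` (inside a
cross the per-direction rank is `≥ 6` somewhere) this proves (`noJointFamily_six_of_R6`):

  `R6 ⇒ H106`, where `R6`: every `6`-dimensional `V ⊆ Sing Z(per_4)` satisfying the row and
  column minors (for all rows `a ≠ b` and columns `m` some `2 × 2` subpermanent of rows `a, b`
  through column `m` vanishes on `V`, and transposed) has a detecting pair of rows, or of columns,
  or lies inside a cross;

and `H106` is the second hypothesis of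
`SymPencilSdcPerFourTwentySixReduction.eq_twentyFive_and_oneRowKernel_of_le_twentyFive`, whence
`eq_twentyFive_and_oneRowKernel_of_R6`: given `H88` (inner rank `≥ 9` along `8`-dimensional
singular subspaces) and the structural statement `R6`, a symmetric representation of `per_4` of size
`≤ 25` has size `25` and a Lagrangian one-row (one-column) kernel.

`R6` is NOT claimed (the `6`-dimensional analogue of g3's `seven_trichotomy` under the extra minors;
the naive version without minors is false — val-width-5674-p1's `SymPencilPerFourSixDimExotic` —
but that witness violates the minors).  Honest framing: conditional assembly; `sdc(per_4) ≥ 25` is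
the tree's value; the crux `SdcSuperquadratic` and `VP ≠ VNP` are untouched.  No definitions, no
named facts. [folklore]
-/

noncomputable section

-- single-conjunct layout: Sub = Summit, duplicated namespace component intended
set_option linter.dupNamespace false

namespace Summit.ValiantsHypothesis.ValiantsHypothesis.Theorems.SymPencilPerFourSixDimDetecting

open Matrix MvPolynomial Finset Module
open Literature.Computability.AlgebraicComplexity
open Literature.Computability.AlgebraicComplexity.AlperBogartVelasco
open Summit.ValiantsHypothesis.ValiantsHypothesis.Theorems.SymPencilPerFourBlocks
open Summit.ValiantsHypothesis.ValiantsHypothesis.Theorems.SymPencilPerFourHessianMinors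
open Summit.ValiantsHypothesis.ValiantsHypothesis.Theorems.SymPencilPerFourLowRankSeven
open Summit.ValiantsHypothesis.ValiantsHypothesis.Theorems.SymPencilPerFourTwoRowsRadical
open Summit.ValiantsHypothesis.ValiantsHypothesis.Theorems.SymPencilPerFourCoordinateRadical
open Summit.ValiantsHypothesis.ValiantsHypothesis.Theorems.SymPencilPerFourDetectingRadical
open Summit.ValiantsHypothesis.ValiantsHypothesis.Theorems.SymPencilBoxFourEquality
open Summit.ValiantsHypothesis.ValiantsHypothesis.Theorems.SymPencilPerFourSixDimZeroCol
open Summit.ValiantsHypothesis.ValiantsHypothesis.Theorems.SymPencilPerFourSixDimGraph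
open Summit.ValiantsHypothesis.ValiantsHypothesis.Theorems.SymPencilPerFourSixDimBlock
open Summit.ValiantsHypothesis.ValiantsHypothesis.Theorems.SymPencilPerFourSixDimCross
open Summit.ValiantsHypothesis.ValiantsHypothesis.Theorems.SymPencilSdcPerFourTwentySixReduction

variable {K : Type*} [Field K]

/-- **A detecting pair of rows is impossible at dimension `6`** for a singular subspace with both
a per-base-point and a per-direction family of `< 6` squares.  See the module docstring.
[folklore] -/
theorem false_of_detecting_rows_six [CharZero K] {ι ι' : Type*} [Fintype ι] [Fintype ι']
    (hι : Fintype.card ι < 6) (hι' : Fintype.card ι' < 6) (V : Submodule K (Fin 4 × Fin 4 → K))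
    (hV3 : ∀ x ∈ V, ∀ (r c : Fin 3 → Fin 4), Function.Injective r → Function.Injective c →
      ((Matrix.of fun i j => x (i, j)).submatrix r c).permanent = 0)
    (h6 : finrank K V = 6) {p q : Fin 4} (hpq : p ≠ q)
    (hdet : ∀ x ∈ V, (∀ j, x (p, j) = 0) → (∀ j, x (q, j) = 0) → x = 0)
    (hW1 : ∀ u : Fin 4 × Fin 4 → K, ∃ (c : ι → K) (Λ : ι → ((Fin 4 × Fin 4 → K) →ₗ[K] K)),
      ∀ y ∈ V, ∃ e₀ e₁ : K, ∀ s : K,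
        eval (u + s • y) (perPoly (Fin 4) K) = e₀ + s * e₁ + s ^ 2 * ∑ k, c k * (Λ k y) ^ 2)
    (hW2 : ∀ y ∈ V, ∃ (c : ι' → K) (Λ : ι' → ((Fin 4 × Fin 4 → K) →ₗ[K] K)),
      ∀ u : Fin 4 × Fin 4 → K, ∃ e₀ e₁ : K, ∀ s : K,
        eval (u + s • y) (perPoly (Fin 4) K) = e₀ + s * e₁ + s ^ 2 * ∑ k, c k * (Λ k u) ^ 2) :
    False := by
  classical
  -- (D1) a zero column `c₀` on the detecting rows
  obtain ⟨c₀, hc₀⟩ := exists_zero_col_of_detecting_rows_six hι' V h6 hpq hdet hW2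
  -- move `(p, q, c₀)` to `(0, 1, 3)`
  obtain ⟨σ, hσ0, hσ1⟩ := exists_perm_zero_one p q hpq
  set τ : Equiv.Perm (Fin 4) := Equiv.swap 3 c₀ with hτ
  set Φ : (Fin 4 × Fin 4 → K) ≃ₗ[K] (Fin 4 × Fin 4 → K) :=
    LinearEquiv.funCongrLeft K K (Equiv.prodCongr σ τ) with hΦ
  have hΦa : ∀ (x : Fin 4 × Fin 4 → K) (i j : Fin 4), Φ x (i, j) = x (σ i, τ j) := fun x i j => rfl
  set V' := V.map Φ.toLinearMap with hV'def
  have hfin : finrank K V' = 6 := by rw [hV'def, LinearEquiv.finrank_map_eq, h6]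
  have hV3' := subperm_vanish_map_prodCongr V σ τ hV3
  have hW1' := sqFamily_map V Φ (fun z => eval_perPoly_comp_prodCongr σ τ z) hW1
  have hdet' : ∀ x ∈ V', (∀ j, x (0, j) = 0) → (∀ j, x (1, j) = 0) → x = 0 := by
    rintro _ ⟨x, hx, rfl⟩ h0 h1
    have hx0 : x = 0 := by
      refine hdet x hx (fun j => ?_) (fun j => ?_)
      · have h := h0 (τ.symm j)
        rw [LinearEquiv.coe_toLinearMap, hΦa, hσ0, Equiv.apply_symm_apply] at h; exact h
      · have h := h1 (τ.symm j)
        rw [LinearEquiv.coe_toLinearMap, hΦa, hσ1, Equiv.apply_symm_apply] at h; exact h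
    rw [hx0, map_zero]
  have hcol' : ∀ x ∈ V', x (0, 3) = 0 ∧ x (1, 3) = 0 := by
    rintro _ ⟨x, hx, rfl⟩
    rw [LinearEquiv.coe_toLinearMap, hΦa, hΦa, hσ0, hσ1, hτ, Equiv.swap_apply_left]
    exact hc₀ x hx
  -- (D2) the other two rows vanish: `V'` is inside the `2 × 3` block
  have hrows := rows_eq_zero_of_detecting01_col3 V' hV3' hfin hdet' hcol'
  -- `V'` is the whole block (dimension `6`)
  set T : Finset (Fin 4 × Fin 4) :=
    (Finset.univ.filter fun p : Fin 4 × Fin 4 => (p.1 = 0 ∨ p.1 = 1) ∧ p.2 ≠ 3) with hTdef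
  have hTcard : T.card = 6 := by rw [hTdef]; decide
  have memT : ∀ p : Fin 4 × Fin 4, p ∈ T ↔ (p.1 = 0 ∨ p.1 = 1) ∧ p.2 ≠ 3 := fun p => by
    rw [hTdef, Finset.mem_filter]; simp
  set C : Submodule K (Fin 4 × Fin 4 → K) :=
    Submodule.span K ↑(T.image fun p => (Pi.single p (1 : K) : Fin 4 × Fin 4 → K)) with hCdef
  have hCle : finrank K C ≤ 6 := by
    rw [hCdef]
    exact (finrank_span_finset_le_card _).trans (Finset.card_image_le.trans hTcard.le)
  have memC : ∀ y : Fin 4 × Fin 4 → K, (∀ p, p ∉ T → y p = 0) → y ∈ C := by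
    intro y hy0
    have hdecomp : y = ∑ p ∈ T, y p • (Pi.single p (1 : K) : Fin 4 × Fin 4 → K) :=
      calc y = ∑ p, (Pi.single p (y p) : Fin 4 × Fin 4 → K) := (Finset.univ_sum_single y).symm
        _ = ∑ p ∈ T, (Pi.single p (y p) : Fin 4 × Fin 4 → K) := by
          symm
          refine Finset.sum_subset (Finset.subset_univ T) fun p _ hp => ?_
          rw [hy0 p hp, Pi.single_zero]
        _ = ∑ p ∈ T, y p • (Pi.single p (1 : K) : Fin 4 × Fin 4 → K) :=
          Finset.sum_congr rfl fun p _ => by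
            ext p'
            by_cases hp : p' = p
            · subst hp; simp
            · simp [hp]
    rw [hdecomp, hCdef]
    exact Submodule.sum_mem _ fun p hp => Submodule.smul_mem _ _
      (Submodule.subset_span (Finset.mem_coe.2 (Finset.mem_image_of_mem _ hp)))
  have hVC : V' ≤ C := by
    intro y hy
    refine memC y fun p hp => ?_
    rw [memT] at hp
    by_cases h0 : p.1 = 0
    · have h3 : p.2 = 3 := by
        by_contra h3; exact hp ⟨Or.inl h0, h3⟩
      have : p = (0, 3) := Prod.ext h0 h3
      rw [this]; exact (hcol' y hy).1
    by_cases h1 : p.1 = 1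
    · have h3 : p.2 = 3 := by
        by_contra h3; exact hp ⟨Or.inr h1, h3⟩
      have : p = (1, 3) := Prod.ext h1 h3
      rw [this]; exact (hcol' y hy).2
    have := hrows y hy p.1 h0 h1 p.2
    simpa using this
  have hVeq : V' = C := Submodule.eq_of_le_of_finrank_le hVC (hCle.trans hfin.ge)
  -- (B) the block carries no per-base-point family with `< 6` squares
  refine false_of_block23_le_of_sqFamily hι V' (fun x hx h03 h13 => ?_) hW1'
  rw [hVeq]
  refine memC x fun p hp => ?_
  rw [memT] at hp
  by_cases h0 : p.1 = 0
  · have h3 : p.2 = 3 := by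
      by_contra h3; exact hp ⟨Or.inl h0, h3⟩
    have : p = (0, 3) := Prod.ext h0 h3
    rw [this]; exact h03
  by_cases h1 : p.1 = 1
  · have h3 : p.2 = 3 := by
      by_contra h3; exact hp ⟨Or.inr h1, h3⟩
    have : p = (1, 3) := Prod.ext h1 h3
    rw [this]; exact h13
  have := hx p.1 p.2 h0 h1
  simpa using this

/-- **A detecting pair of columns is impossible at dimension `6`** (transpose of
`false_of_detecting_rows_six`). [folklore] -/
theorem false_of_detecting_cols_six [CharZero K] {ι ι' : Type*} [Fintype ι] [Fintype ι']
    (hι : Fintype.card ι < 6) (hι' : Fintype.card ι' < 6) (V : Submodule K (Fin 4 × Fin 4 → K))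
    (hV3 : ∀ x ∈ V, ∀ (r c : Fin 3 → Fin 4), Function.Injective r → Function.Injective c →
      ((Matrix.of fun i j => x (i, j)).submatrix r c).permanent = 0)
    (h6 : finrank K V = 6) {p q : Fin 4} (hpq : p ≠ q)
    (hdet : ∀ x ∈ V, (∀ i, x (i, p) = 0) → (∀ i, x (i, q) = 0) → x = 0)
    (hW1 : ∀ u : Fin 4 × Fin 4 → K, ∃ (c : ι → K) (Λ : ι → ((Fin 4 × Fin 4 → K) →ₗ[K] K)),
      ∀ y ∈ V, ∃ e₀ e₁ : K, ∀ s : K,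
        eval (u + s • y) (perPoly (Fin 4) K) = e₀ + s * e₁ + s ^ 2 * ∑ k, c k * (Λ k y) ^ 2)
    (hW2 : ∀ y ∈ V, ∃ (c : ι' → K) (Λ : ι' → ((Fin 4 × Fin 4 → K) →ₗ[K] K)),
      ∀ u : Fin 4 × Fin 4 → K, ∃ e₀ e₁ : K, ∀ s : K,
        eval (u + s • y) (perPoly (Fin 4) K) = e₀ + s * e₁ + s ^ 2 * ∑ k, c k * (Λ k u) ^ 2) :
    False := by
  set Φ : (Fin 4 × Fin 4 → K) ≃ₗ[K] (Fin 4 × Fin 4 → K) :=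
    LinearEquiv.funCongrLeft K K (Equiv.prodComm (Fin 4) (Fin 4)) with hΦ
  have hW1' := sqFamily_map V Φ eval_perPoly_transpose hW1
  have hW2' := sqFamilySwap_map V Φ eval_perPoly_transpose hW2
  have hV3' := subperm_vanish_transpose V hV3
  set V' := V.map Φ.toLinearMap with hV'def
  have hfin : finrank K V' = 6 := by rw [hV'def, LinearEquiv.finrank_map_eq, h6]
  have hdet' : ∀ y ∈ V', (∀ j, y (p, j) = 0) → (∀ j, y (q, j) = 0) → y = 0 := by
    rintro _ ⟨x, hx, rfl⟩ h2 h3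
    have hx0 : x = 0 := hdet x hx (fun i => h2 i) (fun i => h3 i)
    rw [hx0, map_zero]
  exact false_of_detecting_rows_six hι hι' V' hV3' hfin hpq hdet' hW1' hW2'

/-- **`R6 ⇒ H106`.**  If every `6`-dimensional `V ⊆ Sing Z(per_4)` satisfying the row and column
minors has a detecting pair of rows, or of columns, or lies in a cross (`R6`, hypothesis), then
no `6`-dimensional `V ⊆ Sing Z(per_4)` carries a joint (bilinear) family of `< 6` squares —
in particular the hypothesis `H106` (`4` squares) of
`SymPencilSdcPerFourTwentySixReduction.eq_twentyFive_and_oneRowKernel_of_le_twentyFive`.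
[folklore] -/
theorem noJointFamily_six_of_R6 [CharZero K]
    (R6 : ∀ W : Submodule K (Fin 4 × Fin 4 → K),
      (∀ x ∈ W, ∀ (r c : Fin 3 → Fin 4), Function.Injective r → Function.Injective c →
        ((Matrix.of fun i j => x (i, j)).submatrix r c).permanent = 0) →
      finrank K W = 6 →
      (∀ a b m : Fin 4, a ≠ b → ∃ c : Fin 4, c ≠ m ∧
        ∀ y ∈ W, y (a, c) * y (b, m) + y (a, m) * y (b, c) = 0) →
      (∀ a b m : Fin 4, a ≠ b → ∃ c : Fin 4, c ≠ m ∧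
        ∀ y ∈ W, y (c, a) * y (m, b) + y (m, a) * y (c, b) = 0) →
      (∃ p q : Fin 4, p ≠ q ∧ ∀ x ∈ W, (∀ j, x (p, j) = 0) → (∀ j, x (q, j) = 0) → x = 0) ∨
      (∃ p q : Fin 4, p ≠ q ∧ ∀ x ∈ W, (∀ i, x (i, p) = 0) → (∀ i, x (i, q) = 0) → x = 0) ∨
      (∃ l c : Fin 4, ∀ x ∈ W, ∀ i j : Fin 4, i ≠ l → j ≠ c → x (i, j) = 0))
    {d : ℕ} (hd : d < 6) (V : Submodule K (Fin 4 × Fin 4 → K))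
    (hV3 : ∀ x ∈ V, ∀ (r c : Fin 3 → Fin 4), Function.Injective r → Function.Injective c →
      ((Matrix.of fun i j => x (i, j)).submatrix r c).permanent = 0)
    (h6 : finrank K V = 6) (c : Fin d → K)
    (β : Fin d → ((Fin 4 × Fin 4 → K) →ₗ[K] (Fin 4 × Fin 4 → K) →ₗ[K] K)) :
    ¬ (∀ u : Fin 4 × Fin 4 → K, ∀ y ∈ V, ∃ e₀ e₁ : K, ∀ s : K,
        eval (u + s • y) (perPoly (Fin 4) K) = e₀ + s * e₁ + s ^ 2 * ∑ k, c k * (β k u y) ^ 2) := by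
  intro hjoint
  have hdF : Fintype.card (Fin d) < 6 := by rwa [Fintype.card_fin]
  -- the two partial readings of the joint family
  have hW1 : ∀ u : Fin 4 × Fin 4 → K, ∃ (c' : Fin d → K) (Λ : Fin d → ((Fin 4 × Fin 4 → K) →ₗ[K] K)),
      ∀ y ∈ V, ∃ e₀ e₁ : K, ∀ s : K,
        eval (u + s • y) (perPoly (Fin 4) K) = e₀ + s * e₁ + s ^ 2 * ∑ k, c' k * (Λ k y) ^ 2 :=
    fun u => ⟨c, fun k => β k u, fun y hy => hjoint u y hy⟩
  have hW2 : ∀ y ∈ V, ∃ (c' : Fin d → K) (Λ : Fin d → ((Fin 4 × Fin 4 → K) →ₗ[K] K)),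
      ∀ u : Fin 4 × Fin 4 → K, ∃ e₀ e₁ : K, ∀ s : K,
        eval (u + s • y) (perPoly (Fin 4) K) = e₀ + s * e₁ + s ^ 2 * ∑ k, c' k * (Λ k u) ^ 2 :=
    fun y hy => ⟨c, fun k => (β k).flip y, fun u => by
      obtain ⟨e₀, e₁, he⟩ := hjoint u y hy
      exact ⟨e₀, e₁, fun s => by simpa only [LinearMap.flip_apply] using he s⟩⟩
  -- the minors (rows: p2's lemma; columns: on the transposed space)
  have hrow : ∀ a b m : Fin 4, a ≠ b → ∃ c : Fin 4, c ≠ m ∧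
      ∀ y ∈ V, y (a, c) * y (b, m) + y (a, m) * y (b, c) = 0 :=
    fun a b m hab => exists_perm_col_vanish_of_sum_sq_swap hdF V hW2 a b m hab
  have hcolm : ∀ a b m : Fin 4, a ≠ b → ∃ c : Fin 4, c ≠ m ∧
      ∀ y ∈ V, y (c, a) * y (m, b) + y (m, a) * y (c, b) = 0 := by
    intro a b m hab
    set Φ : (Fin 4 × Fin 4 → K) ≃ₗ[K] (Fin 4 × Fin 4 → K) :=
      LinearEquiv.funCongrLeft K K (Equiv.prodComm (Fin 4) (Fin 4)) with hΦ
    have hΦa : ∀ (x : Fin 4 × Fin 4 → K) (i j : Fin 4), Φ x (i, j) = x (j, i) := fun x i j => rfl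
    have hW2' := sqFamilySwap_map V Φ eval_perPoly_transpose hW2
    obtain ⟨c', hc', hq⟩ := exists_perm_col_vanish_of_sum_sq_swap hdF (V.map Φ.toLinearMap) hW2'
      a b m hab
    refine ⟨c', hc', fun y hy => ?_⟩
    have h := hq (Φ y) ⟨y, hy, rfl⟩
    simpa only [hΦa] using h
  rcases R6 V hV3 h6 hrow hcolm with ⟨p, q, hpq, hdet⟩ | ⟨p, q, hpq, hdet⟩ | ⟨l, c₀, hX⟩
  · exact false_of_detecting_rows_six hdF hdF V hV3 h6 hpq hdet hW1 hW2
  · exact false_of_detecting_cols_six hdF hdF V hV3 h6 hpq hdet hW1 hW2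
  · exact false_of_le_cross_six_of_sum_sq_swap hdF V hX h6 hW2

/-- **Rung `26` modulo `H88` and the structural residual `R6`**: given inner rank `≥ 9` along
`8`-dimensional singular subspaces (`H88`, Task T2) and `R6`, a symmetric affine determinantal
representation of `per_4` of size `m ≤ 25` (characteristic `0`) has `m = 25`, Lagrangian kernel
rows and a one-row (one-column) kernel.  (`SymPencilSdcPerFourTwentySixReduction` with `H106`
discharged by `noJointFamily_six_of_R6`.) [folklore] -/
theorem eq_twentyFive_and_oneRowKernel_of_R6 (K : Type*) [Field K] [CharZero K]
    (H88 : ∀ V : Submodule K (Fin 4 × Fin 4 → K),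
      (∀ x ∈ V, ∀ (r c : Fin 3 → Fin 4), Function.Injective r → Function.Injective c →
        ((Matrix.of fun i j => x (i, j)).submatrix r c).permanent = 0) →
      finrank K V = 8 → ∀ (c : Fin 8 → K)
        (β : Fin 8 → ((Fin 4 × Fin 4 → K) →ₗ[K] (Fin 4 × Fin 4 → K) →ₗ[K] K)),
      ¬ (∀ u : Fin 4 × Fin 4 → K, ∀ y ∈ V, ∃ e₀ e₁ : K, ∀ s : K,
          eval (u + s • y) (perPoly (Fin 4) K) = e₀ + s * e₁ + s ^ 2 * ∑ k, c k * (β k u y) ^ 2))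
    (R6 : ∀ W : Submodule K (Fin 4 × Fin 4 → K),
      (∀ x ∈ W, ∀ (r c : Fin 3 → Fin 4), Function.Injective r → Function.Injective c →
        ((Matrix.of fun i j => x (i, j)).submatrix r c).permanent = 0) →
      finrank K W = 6 →
      (∀ a b m : Fin 4, a ≠ b → ∃ c : Fin 4, c ≠ m ∧
        ∀ y ∈ W, y (a, c) * y (b, m) + y (a, m) * y (b, c) = 0) →
      (∀ a b m : Fin 4, a ≠ b → ∃ c : Fin 4, c ≠ m ∧
        ∀ y ∈ W, y (c, a) * y (m, b) + y (m, a) * y (c, b) = 0) →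
      (∃ p q : Fin 4, p ≠ q ∧ ∀ x ∈ W, (∀ j, x (p, j) = 0) → (∀ j, x (q, j) = 0) → x = 0) ∨
      (∃ p q : Fin 4, p ≠ q ∧ ∀ x ∈ W, (∀ i, x (i, p) = 0) → (∀ i, x (i, q) = 0) → x = 0) ∨
      (∃ l c : Fin 4, ∀ x ∈ W, ∀ i j : Fin 4, i ≠ l → j ≠ c → x (i, j) = 0))
    {m : ℕ} (hm : m ≤ 25) {A : Matrix (Fin m) (Fin m) (MvPolynomial (Fin 4 × Fin 4) K)}
    (hS : A.IsSymm) (hA : IsAffineDetRepr (perPoly (Fin 4) K) A) :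
    m = 25 ∧
    ∃ (i₀ : Fin m) (D : Matrix {i // i ≠ i₀} {i // i ≠ i₀} K)
      (bL : (Fin 4 × Fin 4 → K) →ₗ[K] ({i // i ≠ i₀} → K))
      (CL : (Fin 4 × Fin 4 → K) →ₗ[K] Matrix {i // i ≠ i₀} {i // i ≠ i₀} K) (κ : K),
      IsUnit D.det ∧ Dᵀ = D ∧ (∀ z, (CL z)ᵀ = CL z) ∧ κ ≠ 0 ∧
      (∀ z, bL z ⬝ᵥ D⁻¹ *ᵥ bL z = 0) ∧
      (∀ z, bL z ⬝ᵥ (D⁻¹ * CL z * D⁻¹) *ᵥ bL z = 0) ∧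
      (∀ z, D.det * (bL z ⬝ᵥ (D⁻¹ * CL z * D⁻¹ * CL z * D⁻¹) *ᵥ bL z) =
        -(κ * eval z (perPoly (Fin 4) K))) ∧
      2 * finrank K (LinearMap.range bL) = 24 ∧ finrank K (LinearMap.ker bL) = 4 ∧
      ((∃ l : Fin 4, ∀ x ∈ LinearMap.ker bL, ∀ i j : Fin 4, i ≠ l → x (i, j) = 0) ∨
       (∃ c : Fin 4, ∀ x ∈ LinearMap.ker bL, ∀ i j : Fin 4, j ≠ c → x (i, j) = 0)) :=
  eq_twentyFive_and_oneRowKernel_of_le_twentyFive K H88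
    (fun V hV3 h6 c β => noJointFamily_six_of_R6 R6 (by norm_num) V hV3 h6 c β) hm hS hA

end Summit.ValiantsHypothesis.ValiantsHypothesis.Theorems.SymPencilPerFourSixDimDetecting

end
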